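import Mathlib
import Summits.Ventures.PercRepro2.V2SP
import Summits.Ventures.PercRepro2.Tail2D
import Summits.Ventures.PercRepro2.Tail2DCount
import Summits.Ventures.PercRepro2.Tail2DThreePoint

/-!
# Commutativity of the counting tail and the closure lemmas of the M♮ class (seat mine-b, cell pub-perc-repro2)

The counting tail `cnt` (Tail2DCount.lean) of a parallel or series composition does not depend on the
order of the two factors (`cnt_par_comm`, `cnt_ser_comm`).  Hence the class of series–parallel patterns
whose counting tail is M♮-concave (`MTailPat s L := IsMTail (cnt s) L`) is closed under series
composition with another member, and under parallel composition with a factor of max-flow one on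
EITHER side (`MTailPat.par_right`, `MTailPat.par_left`) — the closure lemmas behind `Good.isMTail`
(Tail2DThreePoint.lean), stated for direct use.
-/

open Finset

namespace Summit.Ventures.PercRepro2.Tail2D

open V2Closure

/-- the counting tail of a parallel composition is symmetric in the two factors -/
theorem cnt_par_comm (X Y : V2Closure.SP) (a b : ℤ) : cnt (.par X Y) a b = cnt (.par Y X) a b := by
  unfold cnt
  show (∑ p : X.Conf × Y.Conf, if a ≤ ((X.rLab p.1 + Y.rLab p.2 : ℕ) : ℤ)
      ∧ b ≤ ((X.bLab p.1 + Y.bLab p.2 : ℕ) : ℤ) then (1 : ℝ) else 0)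
    = ∑ p : Y.Conf × X.Conf, if a ≤ ((Y.rLab p.1 + X.rLab p.2 : ℕ) : ℤ)
      ∧ b ≤ ((Y.bLab p.1 + X.bLab p.2 : ℕ) : ℤ) then (1 : ℝ) else 0
  rw [Fintype.sum_prod_type, Fintype.sum_prod_type_right]
  refine Finset.sum_congr rfl (fun x _ => Finset.sum_congr rfl (fun y _ => ?_))
  rw [add_comm (X.rLab x) (Y.rLab y), add_comm (X.bLab x) (Y.bLab y)]

/-- the counting tail of a series composition is symmetric in the two factors -/
theorem cnt_ser_comm (X Y : V2Closure.SP) (a b : ℤ) : cnt (.ser X Y) a b = cnt (.ser Y X) a b := by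
  rw [cnt_ser, cnt_ser, mul_comm]

/-- the patterns whose counting tail is an M♮-concave tail of level `L` -/
def MTailPat (s : V2Closure.SP) (L : ℤ) : Prop := IsMTail (cnt s) L

/-- a free edge -/
theorem MTailPat.free : MTailPat .free 1 := cnt_free_isMTail

/-- series composition -/
theorem MTailPat.ser {s t : V2Closure.SP} {L M : ℤ} (hs : MTailPat s L) (ht : MTailPat t M) :
    MTailPat (.ser s t) (min L M) := by
  unfold MTailPat at *
  have e : cnt (.ser s t) = fun a b => cnt s a b * cnt t a b :=
    funext (fun a => funext (fun b => cnt_ser s t a b))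
  rw [e]; exact IsMTail.mul hs ht

/-- parallel composition with a factor of max-flow one on the right -/
theorem MTailPat.par_right {s : V2Closure.SP} {L : ℤ} (hs : MTailPat s L) (Y : V2Closure.SP)
    (hY : FlowLeOne Y) (h10 : ∃ y : Y.Conf, Y.rLab y = 1 ∧ Y.bLab y = 0)
    (h01 : ∃ y : Y.Conf, Y.rLab y = 0 ∧ Y.bLab y = 1) : MTailPat (.par s Y) (L + 1) :=
  cnt_par_flow1_isMTail hs Y hY h10 h01

/-- parallel composition with a factor of max-flow one on the left -/
theorem MTailPat.par_left {s : V2Closure.SP} {L : ℤ} (hs : MTailPat s L) (Y : V2Closure.SP)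
    (hY : FlowLeOne Y) (h10 : ∃ y : Y.Conf, Y.rLab y = 1 ∧ Y.bLab y = 0)
    (h01 : ∃ y : Y.Conf, Y.rLab y = 0 ∧ Y.bLab y = 1) : MTailPat (.par Y s) (L + 1) := by
  unfold MTailPat
  have e : cnt (.par Y s) = cnt (.par s Y) := funext (fun a => funext (fun b => cnt_par_comm Y s a b))
  rw [e]; exact cnt_par_flow1_isMTail hs Y hY h10 h01

/-- every pattern of the class `Good` is an `MTailPat` -/
theorem MTailPat.of_good {s : V2Closure.SP} {L : ℤ} (h : Good s L) : MTailPat s L := h.isMTail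

/-- a pattern `X ∗ Y` with `Y = e ∧ Z` (a free edge in series with anything) on either side: the flow-one
factor attains `(1, 0)` and `(0, 1)` as soon as `Z` does -/
theorem flowLeOne_ser_free (Z : V2Closure.SP) : FlowLeOne (.ser .free Z) :=
  flowLeOne_ser_left flowLeOne_free Z

end Summit.Ventures.PercRepro2.Tail2D
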